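import Mathlib
import Summits.Ventures.HodgeRepro2.T6N42FlathLift

/-!
# T6N42FlathLiftRead — the reading of a global lift datum at a place, and the residual `hFL`
discharged: `FirstLiftReading.firstLift : D.FirstLift` (owner t6-p5)

Second file of the `hFL` interface (`T6N42FlathLift.lean`: the objects `LocalFactorizationAt` /
`GlobalLiftDatum` with their laws and p3's «global ≠ 0 ⟹ local ≠ 0»). Here, in the same
objects-plus-laws form (t6-p3's concordance note, STATUS l. 12531):
* `ReadAtPlace Gl ω σ π` (objects: the away group and its two away factors, a group isomorphism
  `ι : (G_v × H_v) × G' ≃* G(𝔸) × H(𝔸)` splitting the place off, and the two FACTORIZATION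
  isomorphisms `eΩ : Ω ≃ V ⊗ A₂` (`ω_𝔸 ≅ ω_v ⊗ ω^{(v)}`) and `ePi : Vπ ⊗ ℂ ≃ (V₁ ⊗ V₂) ⊗ B₂`
  (`π₀ ⊠ β′ ≅ (π₀,v ⊠ β′_v) ⊗ (π₀^{(v)} ⊠ β′^{(v)})`)) + `ReadAtPlace.IsReading` (laws: each
  intertwines the global representation pulled back along `ι` with the two-factor tensor product) —
  the Flath factorizations (`T6N42HypFlath.lean`, the field `Factorizable`) read at one place, the
  ONE identification per place that `hIS` (`T6N42FlathDatum.ReadAs`) and `hFL` share (memo §10);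
  `ReadAtPlace.Φ := ePi ∘ Θ ∘ eΩ⁻¹` with `Φ_ne_zero` / `Φ_intertwining` (under the laws),
  `toLocalFactorizationAt` + `isFactorization_toLocalFactorizationAt`, `ReadAtPlace.hasPartner`.
* `FirstLiftReading D` (objects: ONE `GlobalLiftDatum` + a `ReadAtPlace` at every non-split place of
  `D`) + `FirstLiftReading.IsReading` (its laws: the global datum is a lift, every reading is a
  reading); **`FirstLiftReading.firstLift : D.FirstLift`** = the residual `hFL` discharged from the
  host's global objects and factorizations, with NO new print (TIER5 row N2.2.1's argument, p3's
  N2.17.1 witness; the only printed input of the lane stays the Flath display of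
  `T6N42HypFlath.lean`, consumed by `hIS`; the factorization data are the same).
Non-vacuity: `T6N42FlathLiftToy.lean`; the host seam: `T6N42FlathLiftHost.lean`.

Proof lane (structures, `def`s, theorems; no display — nothing here is a printed statement).
README §8(d): uses an L-value-free non-vanishing device: NO (TIER5 §N4.2 / §B, pre-02:16Z lines of
record, continued).

Filed in Tier-6 WAVE 1 as p437823 (proposed 2026-08-26T10:23:49Z, ACCEPTED, commit 7ed73c2106d2);
this v2 differs from the filed bytes in this module docstring only (the staged-record wording
dropped; every declaration byte-identical to v1).
-/

namespace Summit.Ventures.HodgeRepro2.T6.N42Flath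

open Summit.Ventures.HodgeRepro2
open Summit.Ventures.HodgeRepro2.T5DualPairSwap
open Summit.Ventures.HodgeRepro2.T5SplittingTwist
open Summit.Ventures.HodgeRepro2.T5LocalComponent
open Summit.Ventures.HodgeRepro2.T5TrivialPartner
open Summit.Ventures.HodgeRepro2.T6.N42Defs
open Summit.Ventures.HodgeRepro2.T6.N42Datum
open TensorProduct

section Read

variable {G H : Type*} [Monoid G] [Monoid H] {V V₁ V₂ : Type*}
  [AddCommGroup V] [Module ℂ V] [AddCommGroup V₁] [Module ℂ V₁] [AddCommGroup V₂] [Module ℂ V₂]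

/-- The READING of a global datum `Gl` at a place through the datum's local objects `(ω, σ, π)` =
`(ω_{V₀,v}, π₀,v, β′_v)`, OBJECTS: the away group `G'` with its two away factors, a group isomorphism
`ι : (G_v × H_v) × G' ≃* G(𝔸) × H(𝔸)` (the place `v` split off), and the two FACTORIZATION
isomorphisms — `eΩ : Ω ≃ V ⊗ A₂` (`ω_𝔸 ≅ ω_v ⊗ ω^{(v)}`) and `ePi : Vπ ⊗ ℂ ≃ (V₁ ⊗ V₂) ⊗ B₂`
(`π₀ ⊠ β′ ≅ (π₀,v ⊠ β′_v) ⊗ (π₀^{(v)} ⊠ β′^{(v)})`). Its laws (each intertwining the global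
representation pulled back along `ι` with the two-factor tensor product) are `IsReading`. These are
the Flath factorizations (`T6N42HypFlath.lean`, the field `Factorizable`) read at one place — the one
identification per place that `hIS` and `hFL` share (memo §10). -/
structure ReadAtPlace (Gl : GlobalLiftDatum) (ω : Representation ℂ (G × H) V)
    (σ : Representation ℂ G V₁) (π : Representation ℂ H V₂) where
  /-- the away-from-`v` group -/
  G' : Type
  [instMonoid : Monoid G']
  /-- the space of the away factor of `ω_𝔸` -/
  A₂ : Type
  [instAddA : AddCommGroup A₂]
  [instModA : Module ℂ A₂]
  /-- the away factor of `ω_𝔸` -/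
  ω' : Representation ℂ G' A₂
  /-- the space of the away factor of `π₀ ⊠ β′` -/
  B₂ : Type
  [instAddB : AddCommGroup B₂]
  [instModB : Module ℂ B₂]
  /-- the away factor of `π₀ ⊠ β′` -/
  τ₂ : Representation ℂ G' B₂
  /-- the place split off: `(G_v × H_v) × G' ≅ G(𝔸) × H(𝔸)` -/
  ι : (G × H) × G' ≃* Gl.GA × Gl.HA
  /-- the factorization of `ω_𝔸` at `v` -/
  eΩ : Gl.Ω ≃ₗ[ℂ] V ⊗[ℂ] A₂
  /-- the factorization of `π₀ ⊠ β′` at `v` -/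
  ePi : Gl.Vπ ⊗[ℂ] ℂ ≃ₗ[ℂ] (V₁ ⊗[ℂ] V₂) ⊗[ℂ] B₂

namespace ReadAtPlace

variable {Gl : GlobalLiftDatum} {ω : Representation ℂ (G × H) V} {σ : Representation ℂ G V₁}
  {π : Representation ℂ H V₂} (R : ReadAtPlace Gl ω σ π)

/-- The monoid structure of the away group. -/
instance instMonoid' : Monoid R.G' := R.instMonoid

/-- The additive group of the away factor of `ω_𝔸`. -/
instance instAddA' : AddCommGroup R.A₂ := R.instAddA

/-- The `ℂ`-module structure of the away factor of `ω_𝔸`. -/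
instance instModA' : Module ℂ R.A₂ := R.instModA

/-- The additive group of the away factor of `π₀ ⊠ β′`. -/
instance instAddB' : AddCommGroup R.B₂ := R.instAddB

/-- The `ℂ`-module structure of the away factor of `π₀ ⊠ β′`. -/
instance instModB' : Module ℂ R.B₂ := R.instModB

/-- The LAWS of a reading: `eΩ` intertwines `ω_𝔸 ∘ ι` with `ω ⊠ ω'`, and `ePi` intertwines
`(π₀ ⊠ β′) ∘ ι` with `(σ ⊠ π) ⊠ τ₂`. -/
structure IsReading (R : ReadAtPlace Gl ω σ π) : Prop where
  /-- `eΩ` intertwines `ω_𝔸 ∘ ι` with `ω ⊠ ω'` -/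
  eΩ_intertwining : Representation.IsIntertwiningMap (Gl.ωA.comp R.ι.toMonoidHom)
    (extTprod ω R.ω') R.eΩ.toLinearMap
  /-- `ePi` intertwines `(π₀ ⊠ β′) ∘ ι` with `(σ ⊠ π) ⊠ τ₂` -/
  ePi_intertwining : Representation.IsIntertwiningMap
    ((extTprod Gl.πA (charLinRep Gl.βA)).comp R.ι.toMonoidHom) (extTprod (extTprod σ π) R.τ₂)
    R.ePi.toLinearMap

/-- The global theta map read at the place: `Φ := ePi ∘ Θ ∘ eΩ⁻¹`. -/
def Φ : V ⊗[ℂ] R.A₂ →ₗ[ℂ] (V₁ ⊗[ℂ] V₂) ⊗[ℂ] R.B₂ :=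
  (R.ePi.toLinearMap ∘ₗ Gl.Θ) ∘ₗ R.eΩ.symm.toLinearMap

/-- `Φ` applied. -/
theorem Φ_apply (w : V ⊗[ℂ] R.A₂) : R.Φ w = R.ePi (Gl.Θ (R.eΩ.symm w)) := rfl

/-- `Θ` is recovered from `Φ`: `Θ = ePi⁻¹ ∘ Φ ∘ eΩ`. -/
theorem Θ_eq : Gl.Θ = (R.ePi.symm.toLinearMap ∘ₗ R.Φ) ∘ₗ R.eΩ.toLinearMap := by
  ext u
  simp [Φ_apply]

/-- The theta map read at the place is non-zero (TIER5 (E1) transported). -/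
theorem Φ_ne_zero (hG : Gl.IsLift) : R.Φ ≠ 0 := by
  intro h
  apply hG.Θ_ne_zero
  rw [R.Θ_eq, h]
  ext u
  simp

/-- The theta map read at the place is `(G_v × H_v) × G'`-equivariant. -/
theorem Φ_intertwining (hG : Gl.IsLift) (hR : R.IsReading) :
    (extTprod ω R.ω').IsIntertwiningMap (extTprod (extTprod σ π) R.τ₂) R.Φ := by
  have h1 : Representation.IsIntertwiningMap (extTprod ω R.ω') (Gl.ωA.comp R.ι.toMonoidHom)
      R.eΩ.symm.toLinearMap :=
    isIntertwiningMap_symm hR.eΩ_intertwining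
  have h2 : Representation.IsIntertwiningMap (Gl.ωA.comp R.ι.toMonoidHom)
      ((extTprod Gl.πA (charLinRep Gl.βA)).comp R.ι.toMonoidHom) Gl.Θ :=
    ⟨fun x u => hG.Θ_intertwining.isIntertwining (R.ι x) u⟩
  exact isIntertwiningMap_comp_of_isIso h1 (isIntertwiningMap_comp_of_isIso h2 hR.ePi_intertwining)

/-- The reading yields the factorization-at-`v` objects. -/
def toLocalFactorizationAt : LocalFactorizationAt ω σ π where
  G' := R.G'
  A₂ := R.A₂
  ω' := R.ω'
  B₂ := R.B₂
  τ₂ := R.τ₂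
  Φ := R.Φ

/-- … satisfying the factorization laws. -/
theorem isFactorization_toLocalFactorizationAt (hG : Gl.IsLift) (hR : R.IsReading) :
    R.toLocalFactorizationAt.IsFactorization where
  Φ_ne_zero := R.Φ_ne_zero hG
  Φ_intertwining := R.Φ_intertwining hG hR

/-- «global ≠ 0 ⟹ local ≠ 0» through the reading: the local partner at the place. -/
theorem hasPartner (R : ReadAtPlace Gl ω σ π) (hG : Gl.IsLift) (hR : R.IsReading) :
    HasPartner ω σ π :=
  R.toLocalFactorizationAt.hasPartner (R.isFactorization_toLocalFactorizationAt hG hR)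

end ReadAtPlace

end Read

section Datum

/-- The `hFL` READING on an N4.2 datum, OBJECTS: ONE global lift datum and, at every non-split
place, the reading of its theta map through the datum's local objects `(ω_{V₀,v}, π₀,v, β′_v)`. -/
structure FirstLiftReading (D : FinitePlacesDatum) where
  /-- the global lift `π₀ = Θ_{V′→W₁₂}(β′)` with its theta map -/
  global : GlobalLiftDatum
  /-- its reading at every non-split place -/
  read : ∀ v : D.NonsplitPlace,
    ReadAtPlace global ((D.towerDatum v).ω 0) (D.towerDatum v).π (charLinRep (D.β' v))

/-- The LAWS of a first-lift reading: the global datum is a lift and every reading is a reading. -/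
structure FirstLiftReading.IsReading {D : FinitePlacesDatum} (R : FirstLiftReading D) : Prop where
  /-- the global laws -/
  global : R.global.IsLift
  /-- the laws at every non-split place -/
  read : ∀ v, (R.read v).IsReading

/-- **The residual `hFL`, discharged**: a datum with a first-lift reading satisfies `FirstLift` —
«π₀,v = θ_{W₁₂,v}(β′_v)» in the kernel's form `Hom_{G(W)×H(V₀)}(ω_{V₀,v}, π₀,v ⊠ β′_v) ≠ 0` at every
non-split place — from the global theta map and the two factorizations alone (no print beyond the
Flath display that `hIS` consumes; TIER5 row N2.2.1's argument, p3's N2.17.1 witness). -/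
theorem FirstLiftReading.firstLift {D : FinitePlacesDatum} (R : FirstLiftReading D)
    (h : R.IsReading) : D.FirstLift := by
  intro v
  exact (R.read v).hasPartner h.global (h.read v)

end Datum

end Summit.Ventures.HodgeRepro2.T6.N42Flath
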